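import Summits.MatrixMultiplication.MatrixMultiplication.Theorems.ObstructionDescentUniversalOccurrenceTwoRectangleHookTableaux

set_option linter.dupNamespace false
set_option autoImplicit false

/-!
# Universal occurrence — two rectangles and a HOOK, part B: `((2^N),(2^N),(2N-6,2,2,2))` (decomp-mm · lens 3 · gen 43)

Route `route-MatrixMultiplication-ObstructionDescent` (sub-problem `MatrixMultiplication`, `ω(ℂ) = 2`); SUPPORT for the crux
`NoOccurrenceObstruction` (`P_O`, item `stmt-MatrixMultiplication-29040`) through the universal-occurrence programme (NODE-g29…g43
of the decomp-mm cell, lens 3).  Nothing here proves `ω = 2` or closes an item; no `def`, no `sorry`, standard axioms.  Closure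
currency as in parts I–IX: "the triple `(λ⁰,λ¹,λ²)` occurs for `s`" is `isotypicSum₁ λ⁰ (isotypicSum₂ λ¹ (isotypicSum₃ λ² (s^{⊗d}))) ≠ 0`.

**This file.**  `occurs_unitTensor_twoRectangle_doubleHook_three`: for all `m ≥ N ≥ 4` the FOUR-ROW type `((2^N),(2^N),(2N-6,2,2,2))`
occurs for `⟨m⟩` — uniformly in `N`, outside the Chow sector.  Certificate (tools of part A): third-leg vector `M = e_T` for the
column-reading tableau `T = T_4` of `(2N-6,2,2,2)`; colouring `g(i) = i (i ≤ 3), 0 (i ≥ 4)`; block structure `e = e_std ∘ (4 5)(6 7)`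
(positions), i.e. core columns `[(0,s₀),(1,s₀),(0,s₁),(1,s₁)] ‖ [(1,s₂),(0,s₂),(1,s₃),(0,s₃)]` (cells `(block, slot)`, read downwards)
and arm `(q mod 2, q div 2)`, `q ≥ 8`; twist `H = {s₁, s₃}`.  THE HEART (`hVAL` in the proof): a valid pair `σ = (σ₀,σ₁)`
(`σ₀⁻¹σ₁(H) = H`) whose word `g ∘ w_σ` lies in the support of `e_T` has twin core columns — a pigeonhole on the eight core colours
(`omega` on the unpacked validity, arm-vanishing and column-injectivity facts) — hence contributes exactly `1`; the pair
`σ₀ = (s₁ s₂)`, `σ₁ = (s₀ s₁ s₃ s₂)` realises the row word of `T`.  So the floor-law sum is a positive integer (in-seat exact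
enumeration: `24, 72, 576` for `N = 4, 5, 6`).

[cite: BurgisserIkenmeyer2011, §3.4 (Prop. 3.4), Thm. 4.4] [cite: BurgisserIkenmeyer2017, §5, Thm. 5.9 (proof of (2)), eq. (3.4)]
[cite: Landsberg2017, §9.1.1]
-/

noncomputable section

open scoped BigOperators

namespace Summit.MatrixMultiplication.MatrixMultiplication.Theorems.ObstructionCalculus

open Literature.Computability.AlgebraicComplexity
open Literature.NumberTheory.DiophantineGeometry

/-! ### §4 The certificate for `ν = (2N-6, 2, 2, 2)` (four rows): twin columns on the core `[(0,s₀),(1,s₀),(0,s₁),(1,s₁)]`,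
`[(1,s₂),(0,s₂),(1,s₃),(0,s₃)]`, twist `H = {s₁, s₃}` -/

set_option maxHeartbeats 400000 in
/-- **`((2^N),(2^N),(2N-6,2,2,2))` occurs for `⟨m⟩` for all `m ≥ N ≥ 4`** — a four-row type on the third leg, uniformly in
`N` (outside the Chow sector `e' = e`, which only reaches two-row types). [cite: BurgisserIkenmeyer2011, Thm. 4.4]
[cite: BurgisserIkenmeyer2017, Thm. 5.9 (proof of (2))] -/
theorem occurs_unitTensor_twoRectangle_doubleHook_three {N m : ℕ} (hN : 4 ≤ N) (hNm : N ≤ m)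
    {lam : Fin 3 → Nat.Partition (N * 2)} (h0 : lam 0 = Nat.Partition.rectangle N 2)
    (h1 : lam 1 = Nat.Partition.rectangle N 2)
    (h2 : (lam 2).sortedParts = (2 * N - 2 * 3) :: List.replicate 3 2) :
    isotypicSum₁ (lam 0) (isotypicSum₂ (lam 1) (isotypicSum₃ (lam 2)
      (kroneckerPow (unitTensor ℂ m) (N * 2)))) ≠ 0 := by
  classical
  -- the shape and the tableau `T_4`
  have hNY : ∀ x ∈ (lam 2).youngDiagram.cells, x.1 < N := fun x hx => by
    have := fst_lt_of_mem_youngDiagram_doubleHook (lam 2) h2 hx; omega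
  have hd : (lam 2).youngDiagram.cells.card = N * 2 := Nat.Partition.card_cells_youngDiagram _
  obtain ⟨T, hT⟩ : ∃ T : StdFilling (N * 2) (lam 2).youngDiagram, ∀ p : Fin (N * 2), T.1 p =
      (if (p : ℕ) < 3 + 1 then ((p : ℕ), 0) else if (p : ℕ) < 2 * (3 + 1) then ((p : ℕ) - (3 + 1), 1)
        else (0, (p : ℕ) - 2 * (3 + 1) + 2)) :=
    ⟨⟨fun p => if (p : ℕ) < 3 + 1 then ((p : ℕ), 0) else if (p : ℕ) < 2 * (3 + 1) then ((p : ℕ) - (3 + 1), 1)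
        else (0, (p : ℕ) - 2 * (3 + 1) + 2),
      ⟨fun p => hookCell_mem_doubleHook (j := 3) hN (lam 2) h2 p p.2,
       fun p q hpq => Fin.ext (hookCell_injective (3 + 1) hpq),
       fun p q hpq => hookCell_standard (3 + 1) hpq⟩⟩, fun p => rfl⟩
  have hrowT : ∀ q : Fin (N * 2), (T.1 q).1 =
      if (q : ℕ) < 3 + 1 then (q : ℕ) else if (q : ℕ) < 2 * (3 + 1) then (q : ℕ) - (3 + 1) else 0 := fun q => by
    rw [hT]; split_ifs <;> rfl
  have hM : StdFilling.polytabloid ℂ hNY T ∈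
      highestWeightSpace (wordRep ℂ N (N * 2)) (Weight.ofPartition N (lam 2)) := by
    rw [← ydWeight_youngDiagram]; exact StdFilling.polytabloid_mem hNY T hd
  -- the slots and the block structures
  obtain ⟨s0, hs0⟩ : ∃ s : Fin N, (s : ℕ) = 0 := ⟨⟨0, by omega⟩, rfl⟩
  obtain ⟨s1, hs1⟩ : ∃ s : Fin N, (s : ℕ) = 1 := ⟨⟨1, by omega⟩, rfl⟩
  obtain ⟨s2, hs2⟩ : ∃ s : Fin N, (s : ℕ) = 2 := ⟨⟨2, by omega⟩, rfl⟩
  obtain ⟨s3, hs3⟩ : ∃ s : Fin N, (s : ℕ) = 3 := ⟨⟨3, by omega⟩, rfl⟩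
  obtain ⟨p4, hp4⟩ : ∃ p : Fin (N * 2), (p : ℕ) = 4 := ⟨⟨4, by omega⟩, rfl⟩
  obtain ⟨p5, hp5⟩ : ∃ p : Fin (N * 2), (p : ℕ) = 5 := ⟨⟨5, by omega⟩, rfl⟩
  obtain ⟨p6, hp6⟩ : ∃ p : Fin (N * 2), (p : ℕ) = 6 := ⟨⟨6, by omega⟩, rfl⟩
  obtain ⟨p7, hp7⟩ : ∃ p : Fin (N * 2), (p : ℕ) = 7 := ⟨⟨7, by omega⟩, rfl⟩
  obtain ⟨ξ, hξ⟩ : ∃ ξ : Equiv.Perm (Fin (N * 2)), ξ = Equiv.swap p4 p5 * Equiv.swap p6 p7 := ⟨_, rfl⟩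
  have hξv : ∀ q : Fin (N * 2), ((ξ q : Fin (N * 2)) : ℕ) =
      if (q : ℕ) = 4 then 5 else if (q : ℕ) = 5 then 4 else if (q : ℕ) = 6 then 7
        else if (q : ℕ) = 7 then 6 else (q : ℕ) := by
    intro q
    rw [hξ, Equiv.Perm.mul_apply, Equiv.swap_apply_def, Equiv.swap_apply_def]
    simp only [Fin.ext_iff, hp4, hp5, hp6, hp7]
    split_ifs <;> omega
  obtain ⟨e, he⟩ : ∃ e : Fin (N * 2) ≃ Fin 2 × Fin N,
      e = ξ.trans (finProdFinEquiv.symm.trans (Equiv.prodComm (Fin N) (Fin 2))) := ⟨_, rfl⟩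
  have hev : ∀ q : Fin (N * 2), (((e q).1 : Fin 2) : ℕ) = ((ξ q : Fin (N * 2)) : ℕ) % 2 ∧
      (((e q).2 : Fin N) : ℕ) = ((ξ q : Fin (N * 2)) : ℕ) / 2 := by
    intro q; rw [he]; simp [Fin.modNat, Fin.divNat]
  obtain ⟨H, hH⟩ : ∃ H : Finset (Fin N), H = {s1, s3} := ⟨_, rfl⟩
  have hHv : ∀ s : Fin N, s ∈ H ↔ (s : ℕ) = 1 ∨ (s : ℕ) = 3 := by
    intro s; rw [hH, Finset.mem_insert, Finset.mem_singleton, Fin.ext_iff, Fin.ext_iff, hs1, hs3]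
  let F : Fin 2 × Fin N → Fin 2 × Fin N := fun x => (if x.2 ∈ H then Fin.rev x.1 else x.1, x.2)
  have hF : Function.Involutive F := by
    rintro ⟨a, s⟩; by_cases hs : s ∈ H <;> simp [F, hs, Fin.rev_rev]
  obtain ⟨e', he'⟩ : ∃ e' : Fin (N * 2) ≃ Fin 2 × Fin N,
      ∀ q, e' q = (if (e q).2 ∈ H then Fin.rev (e q).1 else (e q).1, (e q).2) :=
    ⟨e.trans (Function.Involutive.toPerm F hF), fun q => rfl⟩
  obtain ⟨g, hg⟩ : ∃ g : Fin N → Fin N, ∀ i, g i = if (i : ℕ) ≤ 3 then i else s0 := ⟨_, fun i => rfl⟩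
  have hgv : ∀ i : Fin N, ((g i : Fin N) : ℕ) = if (i : ℕ) ≤ 3 then (i : ℕ) else 0 := by
    intro i; rw [hg]; split_ifs <;> omega
  have hginj : ∀ i i' : Fin N, g i = g i' → ((g i : Fin N) : ℕ) ≠ 0 → i = i' := by
    intro i i' hii' hne
    have h1 := hgv i
    have h2 := hgv i'
    rw [hii'] at h1 hne
    apply Fin.ext
    split_ifs at h1 h2 <;> omega
  -- evaluation of the words `g ∘ w_σ` at the positions
  have hpos : ∀ (σ : Fin 2 → Equiv.Perm (Fin N)) (n : ℕ) (hn : n < N * 2) (a : Fin 2) (s : Fin N),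
      (if n = 4 then 5 else if n = 5 then 4 else if n = 6 then 7 else if n = 7 then 6 else n) % 2 = (a : ℕ) →
      (if n = 4 then 5 else if n = 5 then 4 else if n = 6 then 7 else if n = 7 then 6 else n) / 2 = (s : ℕ) →
      (g ∘ fun q => σ (e q).1 (e q).2) ⟨n, hn⟩ = g (σ a s) := by
    intro σ n hn a s ha hs
    obtain ⟨h1, h2⟩ := hev ⟨n, hn⟩
    rw [hξv] at h1 h2
    dsimp only at h1 h2
    have ha' : (e ⟨n, hn⟩).1 = a := Fin.ext (by rw [h1, ha])
    have hs' : (e ⟨n, hn⟩).2 = s := Fin.ext (by rw [h2, hs])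
    show g (σ (e ⟨n, hn⟩).1 (e ⟨n, hn⟩).2) = _
    rw [ha', hs']
  -- THE HEART: a valid term with `e_T(g ∘ w_σ) ≠ 0` has twin columns, hence `e_T(g ∘ w_σ) = 1`
  have hVAL : ∀ σ : Fin 2 → Equiv.Perm (Fin N), (∀ s, (σ 0)⁻¹ (σ 1 s) ∈ H ↔ s ∈ H) →
      StdFilling.polytabloid ℂ hNY T (g ∘ fun q => σ (e q).1 (e q).2) ≠ 0 →
      StdFilling.polytabloid ℂ hNY T (g ∘ fun q => σ (e q).1 (e q).2) = 1 := by
    intro σ hval hz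
    obtain ⟨harm, hlt, hinj0, hinj1⟩ := hookTableau_support hNY T hT hz
    have hi0 : ∀ x, σ 0 ((σ 0)⁻¹ x) = x := fun x => (σ 0).apply_symm_apply x
    have hi0' : ∀ x, (σ 0)⁻¹ (σ 0 x) = x := fun x => (σ 0).symm_apply_apply x
    have hi1 : ∀ x, σ 1 ((σ 1)⁻¹ x) = x := fun x => (σ 1).apply_symm_apply x
    -- core values
    have u0 := hpos σ 0 (by omega) 0 s0 (by norm_num) (by norm_num [hs0])
    have u1 := hpos σ 1 (by omega) 1 s0 (by norm_num) (by norm_num [hs0])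
    have u2 := hpos σ 2 (by omega) 0 s1 (by norm_num) (by norm_num [hs1])
    have u3 := hpos σ 3 (by omega) 1 s1 (by norm_num) (by norm_num [hs1])
    have u4 := hpos σ 4 (by omega) 1 s2 (by norm_num) (by norm_num [hs2])
    have u5 := hpos σ 5 (by omega) 0 s2 (by norm_num) (by norm_num [hs2])
    have u6 := hpos σ 6 (by omega) 1 s3 (by norm_num) (by norm_num [hs3])
    have u7 := hpos σ 7 (by omega) 0 s3 (by norm_num) (by norm_num [hs3])
    -- arm values vanish
    have harm0 : ∀ s : Fin N, 4 ≤ (s : ℕ) → ((g (σ 0 s) : Fin N) : ℕ) = 0 := by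
      intro s hs
      have h := hpos σ (2 * s) (by omega) 0 s (by split_ifs <;> omega) (by split_ifs <;> omega)
      rw [← h]; exact harm _ (by simp; omega)
    have harm1 : ∀ s : Fin N, 4 ≤ (s : ℕ) → ((g (σ 1 s) : Fin N) : ℕ) = 0 := by
      intro s hs
      have h := hpos σ (2 * s + 1) (by omega) 1 s (by split_ifs <;> omega) (by split_ifs <;> omega)
      rw [← h]; exact harm _ (by simp; omega)
    -- validity unpacked
    have hvL : ∀ s : Fin N, (s : ℕ) = 0 ∨ (s : ℕ) = 2 →
        ((g (σ 1 s) : Fin N) : ℕ) = ((g (σ 0 s0) : Fin N) : ℕ) ∨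
        ((g (σ 1 s) : Fin N) : ℕ) = ((g (σ 0 s2) : Fin N) : ℕ) ∨ ((g (σ 1 s) : Fin N) : ℕ) = 0 := by
      intro s hs
      set t := (σ 0)⁻¹ (σ 1 s) with ht
      have htH : t ∉ H := fun h => by have := (hval s).1 h; rw [hHv] at this; omega
      have hts : σ 1 s = σ 0 t := by rw [ht, hi0]
      rw [hHv] at htH
      rw [hts]
      by_cases ht0 : (t : ℕ) = 0
      · left; rw [show t = s0 from Fin.ext (ht0.trans hs0.symm)]
      · by_cases ht2 : (t : ℕ) = 2
        · right; left; rw [show t = s2 from Fin.ext (ht2.trans hs2.symm)]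
        · right; right; exact harm0 t (by omega)
    have hvL' : ∀ s : Fin N, (s : ℕ) = 0 ∨ (s : ℕ) = 2 →
        ((g (σ 0 s) : Fin N) : ℕ) = ((g (σ 1 s0) : Fin N) : ℕ) ∨
        ((g (σ 0 s) : Fin N) : ℕ) = ((g (σ 1 s2) : Fin N) : ℕ) ∨ ((g (σ 0 s) : Fin N) : ℕ) = 0 := by
      intro s hs
      set t := (σ 1)⁻¹ (σ 0 s) with ht
      have htH : t ∉ H := fun h => by
        have := (hval t).2 h; rw [ht, hi1, hi0', hHv] at this; omega
      have hts : σ 0 s = σ 1 t := by rw [ht, hi1]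
      rw [hHv] at htH
      rw [hts]
      by_cases ht0 : (t : ℕ) = 0
      · left; rw [show t = s0 from Fin.ext (ht0.trans hs0.symm)]
      · by_cases ht2 : (t : ℕ) = 2
        · right; left; rw [show t = s2 from Fin.ext (ht2.trans hs2.symm)]
        · right; right; exact harm1 t (by omega)
    have hvH : ∀ s : Fin N, (s : ℕ) = 1 ∨ (s : ℕ) = 3 →
        ((g (σ 1 s) : Fin N) : ℕ) = ((g (σ 0 s1) : Fin N) : ℕ) ∨
        ((g (σ 1 s) : Fin N) : ℕ) = ((g (σ 0 s3) : Fin N) : ℕ) := by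
      intro s hs
      set t := (σ 0)⁻¹ (σ 1 s) with ht
      have htH : t ∈ H := (hval s).2 (by rw [hHv]; exact hs)
      have hts : σ 1 s = σ 0 t := by rw [ht, hi0]
      rw [hHv] at htH
      rw [hts]
      rcases htH with ht1 | ht3
      · left; rw [show t = s1 from Fin.ext (ht1.trans hs1.symm)]
      · right; rw [show t = s3 from Fin.ext (ht3.trans hs3.symm)]
    -- injectivity away from the colour `0`
    have hA02 : ((g (σ 0 s0) : Fin N) : ℕ) = ((g (σ 0 s2) : Fin N) : ℕ) → ((g (σ 0 s0) : Fin N) : ℕ) = 0 := by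
      intro h; by_contra hne
      have := (σ 0).injective (hginj _ _ (Fin.ext h) hne)
      rw [Fin.ext_iff, hs0, hs2] at this; omega
    have hB02 : ((g (σ 1 s0) : Fin N) : ℕ) = ((g (σ 1 s2) : Fin N) : ℕ) → ((g (σ 1 s0) : Fin N) : ℕ) = 0 := by
      intro h; by_contra hne
      have := (σ 1).injective (hginj _ _ (Fin.ext h) hne)
      rw [Fin.ext_iff, hs0, hs2] at this; omega
    -- column injectivity
    have hc01 : ((g (σ 0 s0) : Fin N) : ℕ) ≠ ((g (σ 1 s0) : Fin N) : ℕ) := by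
      intro h
      have := hinj0 ⟨0, by omega⟩ ⟨1, by omega⟩ (by norm_num) (by norm_num) (by rw [u0, u1]; exact Fin.ext h)
      simp [Fin.ext_iff] at this
    have hc23 : ((g (σ 0 s1) : Fin N) : ℕ) ≠ ((g (σ 1 s1) : Fin N) : ℕ) := by
      intro h
      have := hinj0 ⟨2, by omega⟩ ⟨3, by omega⟩ (by norm_num) (by norm_num) (by rw [u2, u3]; exact Fin.ext h)
      simp [Fin.ext_iff] at this
    have hc45 : ((g (σ 1 s2) : Fin N) : ℕ) ≠ ((g (σ 0 s2) : Fin N) : ℕ) := by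
      intro h
      have := hinj1 ⟨4, by omega⟩ ⟨5, by omega⟩ (by norm_num) (by norm_num) (by norm_num) (by norm_num)
        (by rw [u4, u5]; exact Fin.ext h)
      simp [Fin.ext_iff] at this
    have hc67 : ((g (σ 1 s3) : Fin N) : ℕ) ≠ ((g (σ 0 s3) : Fin N) : ℕ) := by
      intro h
      have := hinj1 ⟨6, by omega⟩ ⟨7, by omega⟩ (by norm_num) (by norm_num) (by norm_num) (by norm_num)
        (by rw [u6, u7]; exact Fin.ext h)
      simp [Fin.ext_iff] at this
    -- the twin equalities
    have hb0 := hvL s0 (Or.inl hs0)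
    have hb2 := hvL s2 (Or.inr hs2)
    have ha0 := hvL' s0 (Or.inl hs0)
    have ha2 := hvL' s2 (Or.inr hs2)
    have hb1 := hvH s1 (Or.inl hs1)
    have hb3 := hvH s3 (Or.inr hs3)
    have E4 : ((g (σ 1 s2) : Fin N) : ℕ) = ((g (σ 0 s0) : Fin N) : ℕ) := by omega
    have E5 : ((g (σ 0 s2) : Fin N) : ℕ) = ((g (σ 1 s0) : Fin N) : ℕ) := by omega
    have E6 : ((g (σ 1 s3) : Fin N) : ℕ) = ((g (σ 0 s1) : Fin N) : ℕ) := by omega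
    have E7 : ((g (σ 0 s3) : Fin N) : ℕ) = ((g (σ 1 s1) : Fin N) : ℕ) := by omega
    apply hookTableau_twin_eq_one hNY T hT (by omega) harm (fun p hp => hlt p (by omega)) hinj0
    intro p hp
    obtain ⟨n, hn⟩ := p
    dsimp only at hp ⊢
    have hn4 : n = 0 ∨ n = 1 ∨ n = 2 ∨ n = 3 := by omega
    rcases hn4 with rfl | rfl | rfl | rfl
    · rw [u0]; exact (u4.trans (Fin.ext E4))
    · rw [u1]; exact (u5.trans (Fin.ext E5))
    · rw [u2]; exact (u6.trans (Fin.ext E6))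
    · rw [u3]; exact (u7.trans (Fin.ext E7))
  -- the summands are `0` or `1`
  have hterm : ∀ σ : Fin 2 → Equiv.Perm (Fin N),
      (∏ a, ((Equiv.Perm.sign (σ a) : ℤ) : ℂ)) *
          (wordBlockSign ℂ e' (fun q => σ (e q).1 (e q).2) *
            ∑ w, StdFilling.polytabloid ℂ hNY T w *
              ∏ q, (fun i l : Fin N => if l = g i then (1 : ℂ) else 0) (σ (e q).1 (e q).2) (w q)) =
        if (∀ s, (σ 0)⁻¹ (σ 1 s) ∈ H ↔ s ∈ H) ∧
            StdFilling.polytabloid ℂ hNY T (g ∘ fun q => σ (e q).1 (e q).2) ≠ 0 then 1 else 0 := by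
    intro σ
    have hc : (∑ w, StdFilling.polytabloid ℂ hNY T w *
        ∏ q, (fun i l : Fin N => if l = g i then (1 : ℂ) else 0) (σ (e q).1 (e q).2) (w q)) =
        StdFilling.polytabloid ℂ hNY T (g ∘ fun q => σ (e q).1 (e q).2) :=
      sum_mul_prod_indicator_eq _ g _
    rw [hc, ← mul_assoc, sign_mul_wordBlockSign_twist e e' H he' σ]
    by_cases hval : ∀ s, (σ 0)⁻¹ (σ 1 s) ∈ H ↔ s ∈ H
    · rw [if_pos hval, one_mul]
      by_cases hz : StdFilling.polytabloid ℂ hNY T (g ∘ fun q => σ (e q).1 (e q).2) = 0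
      · rw [if_neg (fun h => h.2 hz), hz]
      · rw [if_pos ⟨hval, hz⟩]
        exact hVAL σ hval hz
    · rw [if_neg hval, zero_mul, if_neg (fun h => hval h.1)]
  refine occurs_unitTensor_twoRectangle_of_pairing_ne_zero hNm e e' h0 h1 hM
    (fun i l => if l = g i then (1 : ℂ) else 0) ?_
  intro hsum
  rw [Finset.sum_congr rfl (fun σ _ => hterm σ), Finset.sum_boole, Nat.cast_eq_zero,
    Finset.card_eq_zero, Finset.filter_eq_empty_iff] at hsum
  -- the witness: `σ₀ = (s₁ s₂)`, `σ₁ = (s₀ s₁ s₃ s₂)`, for which `g ∘ w_σ` is the row word of `T`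
  obtain ⟨σw, hw0, hw1⟩ : ∃ σw : Fin 2 → Equiv.Perm (Fin N),
      σw 0 = Equiv.swap s1 s2 ∧ σw 1 = Equiv.swap s0 s1 * Equiv.swap s1 s3 * Equiv.swap s3 s2 :=
    ⟨![Equiv.swap s1 s2, Equiv.swap s0 s1 * Equiv.swap s1 s3 * Equiv.swap s3 s2], rfl, rfl⟩
  apply hsum (Finset.mem_univ σw)
  have hsw0 : ∀ s : Fin N, ((σw 0 s : Fin N) : ℕ) =
      if (s : ℕ) = 1 then 2 else if (s : ℕ) = 2 then 1 else (s : ℕ) := by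
    intro s
    rw [hw0, Equiv.swap_apply_def]
    simp only [Fin.ext_iff, hs1, hs2]
    split_ifs <;> omega
  have hsw1 : ∀ s : Fin N, ((σw 1 s : Fin N) : ℕ) =
      if (s : ℕ) = 0 then 1 else if (s : ℕ) = 1 then 3 else if (s : ℕ) = 2 then 0
        else if (s : ℕ) = 3 then 2 else (s : ℕ) := by
    intro s
    rw [hw1, Equiv.Perm.mul_apply, Equiv.Perm.mul_apply, Equiv.swap_apply_def, Equiv.swap_apply_def,
      Equiv.swap_apply_def]
    simp only [Fin.ext_iff, hs0, hs1, hs2, hs3]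
    split_ifs <;> omega
  constructor
  · -- validity
    intro s
    have hi0 : ∀ x, σw 0 ((σw 0)⁻¹ x) = x := fun x => (σw 0).apply_symm_apply x
    set t := (σw 0)⁻¹ (σw 1 s) with ht
    have h1 : ((σw 0 t : Fin N) : ℕ) = ((σw 1 s : Fin N) : ℕ) := by rw [ht, hi0]
    rw [hsw0, hsw1] at h1
    rw [hHv, hHv]
    split_ifs at h1 <;> omega
  · -- `g ∘ w_σ = w_T`
    have hwrd : (g ∘ fun q => σw (e q).1 (e q).2) = StdFilling.rowWord hNY T := by
      funext q
      obtain ⟨n, hn⟩ := q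
      apply Fin.ext
      show _ = (T.1 ⟨n, hn⟩).1
      rw [hrowT]
      dsimp only
      by_cases hn8 : n < 8
      · have hcases : n = 0 ∨ n = 1 ∨ n = 2 ∨ n = 3 ∨ n = 4 ∨ n = 5 ∨ n = 6 ∨ n = 7 := by omega
        rcases hcases with rfl | rfl | rfl | rfl | rfl | rfl | rfl | rfl
        · rw [hpos σw 0 hn 0 s0 (by norm_num) (by norm_num [hs0]), hgv, hsw0]; simp [hs0]
        · rw [hpos σw 1 hn 1 s0 (by norm_num) (by norm_num [hs0]), hgv, hsw1]; simp [hs0]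
        · rw [hpos σw 2 hn 0 s1 (by norm_num) (by norm_num [hs1]), hgv, hsw0]; simp [hs1]
        · rw [hpos σw 3 hn 1 s1 (by norm_num) (by norm_num [hs1]), hgv, hsw1]; simp [hs1]
        · rw [hpos σw 4 hn 1 s2 (by norm_num) (by norm_num [hs2]), hgv, hsw1]; simp [hs2]
        · rw [hpos σw 5 hn 0 s2 (by norm_num) (by norm_num [hs2]), hgv, hsw0]; simp [hs2]
        · rw [hpos σw 6 hn 1 s3 (by norm_num) (by norm_num [hs3]), hgv, hsw1]; simp [hs3]
        · rw [hpos σw 7 hn 0 s3 (by norm_num) (by norm_num [hs3]), hgv, hsw0]; simp [hs3]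
      · -- arm
        have ha : (if n = 4 then 5 else if n = 5 then 4 else if n = 6 then 7 else if n = 7 then 6 else n) % 2 =
            (((⟨n % 2, by omega⟩ : Fin 2) : Fin 2) : ℕ) := by dsimp only; split_ifs <;> omega
        have hs : (if n = 4 then 5 else if n = 5 then 4 else if n = 6 then 7 else if n = 7 then 6 else n) / 2 =
            (((⟨n / 2, by omega⟩ : Fin N) : Fin N) : ℕ) := by dsimp only; split_ifs <;> omega
        rw [hpos σw n hn ⟨n % 2, by omega⟩ ⟨n / 2, by omega⟩ ha hs, hgv]
        have hfix : ((σw ⟨n % 2, by omega⟩ ⟨n / 2, by omega⟩ : Fin N) : ℕ) = n / 2 := by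
          have : (⟨n % 2, by omega⟩ : Fin 2) = 0 ∨ (⟨n % 2, by omega⟩ : Fin 2) = 1 := by
            rcases Nat.mod_two_eq_zero_or_one n with h | h
            · left; exact Fin.ext h
            · right; exact Fin.ext h
          rcases this with h | h
          · rw [h, hsw0]; dsimp only; split_ifs <;> omega
          · rw [h, hsw1]; dsimp only; split_ifs <;> omega
        rw [hfix]
        split_ifs <;> omega
    rw [hwrd, StdFilling.polytabloid_apply_rowWord]
    exact one_ne_zero

end Summit.MatrixMultiplication.MatrixMultiplication.Theorems.ObstructionCalculus
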